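import Mathlib
import Summits.RiemannHypothesis.RiemannHypothesis.Theorems.WeilGroundStateGroundStatesConvergeToXiRHofTight
import Summits.RiemannHypothesis.RiemannHypothesis.Theorems.WeilGroundStateGroundStatesConvergeToXiUniformBoundHalf
import Summits.RiemannHypothesis.RiemannHypothesis.Theorems.WeilGroundStateGroundStatesConvergeToXiLineExactWeak
import Summits.RiemannHypothesis.RiemannHypothesis.Theorems.WeilGroundStateGroundStatesConvergeToXiStubPointwiseOfWeak
import Summits.RiemannHypothesis.RiemannHypothesis.Theorems.GronwallLeakage.Negative.LoadBearing
import Literature.NumberTheory.LFunctions.WeilGroundState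
import HarnessLib

/-!
# RH from ground states tight at the polar exponent `b₀ = 1/2`
(crux item stmt-RiemannHypothesis-1527 `GroundStatesConvergeToXi`, route
route-RiemannHypothesis-WeilGroundState, line `Sketch`; `--supports`)

`…RHofTight.lean` proves: renormalised ground states `c_k u_k` bounded in ONE weighted
`L¹(e^{b₀|t|})`, `b₀ > 1/2`, with one non-degenerate test pairing, imply RH.  With the uniform
bound at the polar exponent (`norm_weilFunctional_weilConv_weilReflect_le_half`, Chebyshev) the
threshold drops to `b₀ = 1/2`:

* `riemannHypothesis_of_nondegenerate_halfTight_groundStates` — `∫ |c_k u_k| e^{|t|/2} ≤ M` and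
  `‖⟨c_k u_k, h₀⟩‖ ≥ η > 0` for one test `h₀` ⇒ RH;
* `riemannHypothesis_of_halfTight_weakLimit_ne_zero` (NV at `1/2`),
  `riemannHypothesis_of_halfTightWeakLimit` (C⁺ with tightness at `1/2` ⇒ RH);
* `riemannHypothesis_of_halfTight_cruxWitness`,
  `riemannHypothesis_of_groundStatesConvergeToXi_halfTight` — **a witness of the crux whose
  renormalised ground states have bounded polar integrals `∫ |c_k u_k| e^{|t|/2}` proves RH**;
  `not_halfTight_cruxWitness_of_not_riemannHypothesis` — under ¬RH the polar integrals of
  every witness of the crux are unbounded.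

THE DICHOTOMY AT THE POLAR EXPONENT.  The line's open stub C⁺ asks tightness for every
`b < 1/2` — exactly what the OPEN strip sees (`|e^{(s-1/2)t}| = e^{(Re s - 1/2)t}`,
`|Re s - 1/2| < 1/2`), and for non-negative ground states no more than the crux itself
(`tightWeakLimit_of_nonneg_cruxWitness`).  Tightness AT `b = 1/2` — the weight of the polar term
`ĝ(0) + ĝ(1)` of Weil's functional, i.e. of the CLOSED strip — already implies RH.  Nothing
RH-free is left between the two.
-/

noncomputable section

set_option linter.dupNamespace false

open scoped Topology Real ComplexConjugate
open Filter Set MeasureTheory Complex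

namespace Summit.RiemannHypothesis.RiemannHypothesis.Theorems.GroundStatesConvergeToXi

open Literature.NumberTheory.LFunctions

/-- **RH from non-degenerate ground states tight at the polar exponent.**  Suppose that along
windows `a_k → ∞` there are ground states `u_k` (`IsWeilGroundState (a k) (u k)`) and scalars
`c_k` with `∫ |c_k u_k| e^{|t|/2} ≤ M` for all `k`, and ONE test function `h₀` with
`‖∫ c_k u_k h̄₀‖ ≥ η > 0` for all `k`.  Then RH.  Proof as in
`riemannHypothesis_of_nondegenerate_tight_groundStates`, with the uniform bound
`‖W(f ⋆ h̃₀)‖ ≤ C ∫|f|e^{|t|/2}` (`norm_weilFunctional_weilConv_weilReflect_le_half`): the weak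
Euler–Lagrange equation gives `|ε(a_k)| η ≤ C M`, `ε` is non-increasing, hence bounded below on
`a > 0`, hence RH (`riemannHypothesis_of_weilGroundEnergy_bddBelow`). -/
theorem riemannHypothesis_of_nondegenerate_halfTight_groundStates
    (h : ∃ a : ℕ → ℝ, ∃ u : ℕ → ℝ → ℂ, ∃ c : ℕ → ℂ, Tendsto a atTop atTop ∧
      (∀ k, IsWeilGroundState (a k) (u k)) ∧
      (∃ M : ℝ, ∀ k, ∫ t, ‖c k * u k t‖ * Real.exp (1 / 2 * |t|) ≤ M) ∧
      (∃ h₀ : ℝ → ℂ, IsWeilTest h₀ ∧ ∃ η : ℝ, 0 < η ∧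
        ∀ k, η ≤ ‖∫ t, c k * u k t * conj (h₀ t)‖)) :
    RiemannHypothesis := by
  obtain ⟨a, u, c, ha, hu, ⟨M, hM⟩, ⟨h₀, hh₀, η, hη, hηk⟩⟩ := h
  obtain ⟨C, hC0, hC⟩ := norm_weilFunctional_weilConv_weilReflect_le_half hh₀
  -- a symmetric interval containing the support of `h₀`
  obtain ⟨r, hr⟩ : ∃ r : ℝ, tsupport h₀ ⊆ Icc (-r) r := by
    obtain ⟨R, hR⟩ := hh₀.2.isCompact.isBounded.subset_closedBall 0
    refine ⟨R, fun t ht => ?_⟩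
    have := hR ht
    rw [Metric.mem_closedBall, dist_zero_right, Real.norm_eq_abs] at this
    exact ⟨by linarith [neg_abs_le t], le_abs_self t |>.trans this⟩
  apply riemannHypothesis_of_weilGroundEnergy_bddBelow
  refine ⟨-(C * M / η), fun A hA => ?_⟩
  -- a window `a k` beyond `A` and `r`
  obtain ⟨k, hk⟩ : ∃ k, max A r ≤ a k := (ha.eventually (eventually_ge_atTop _)).exists
  have hAk : A ≤ a k := (le_max_left _ _).trans hk
  have hrk : r ≤ a k := (le_max_right _ _).trans hk
  -- the bound at window `a k`
  have key : |weilGroundEnergy (a k)| * η ≤ C * M := by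
    obtain ⟨hu2, g, hg, hQ, hL⟩ := hu k
    have hsupp : tsupport h₀ ⊆ Icc (-(a k)) (a k) :=
      hr.trans (Icc_subset_Icc (neg_le_neg hrk) hrk)
    have hEL := groundState_eulerLagrange hg hQ hu2 hL hh₀ hsupp
    have hW := tendsto_integral_norm_mul_exp_of_minimizingSeq ⟨hu2, g, hg, hQ, hL⟩ hg hL (1 / 2)
    have h1 : ‖(weilGroundEnergy (a k) : ℂ) * ∫ t, u k t * conj (h₀ t)‖ ≤
        C * ∫ t, ‖u k t‖ * Real.exp (1 / 2 * |t|) :=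
      le_of_tendsto_of_tendsto' hEL.norm (hW.const_mul C) fun n => hC (g n) (hg n).1
    have h2 : ‖c k‖ * (C * ∫ t, ‖u k t‖ * Real.exp (1 / 2 * |t|)) =
        C * ∫ t, ‖c k * u k t‖ * Real.exp (1 / 2 * |t|) := by
      rw [← integral_const_mul, ← integral_const_mul, ← integral_const_mul]
      congr 1 with t
      rw [norm_mul]
      ring
    have h3 : ‖c k‖ * ‖(weilGroundEnergy (a k) : ℂ) * ∫ t, u k t * conj (h₀ t)‖ =
        |weilGroundEnergy (a k)| * ‖∫ t, c k * u k t * conj (h₀ t)‖ := by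
      have hfun : (fun t => c k * u k t * conj (h₀ t)) = fun t => c k * (u k t * conj (h₀ t)) := by
        funext t; ring
      rw [hfun, integral_const_mul, norm_mul, norm_mul, Complex.norm_real, Real.norm_eq_abs]
      ring
    calc |weilGroundEnergy (a k)| * η
        ≤ |weilGroundEnergy (a k)| * ‖∫ t, c k * u k t * conj (h₀ t)‖ :=
          mul_le_mul_of_nonneg_left (hηk k) (abs_nonneg _)
      _ = ‖c k‖ * ‖(weilGroundEnergy (a k) : ℂ) * ∫ t, u k t * conj (h₀ t)‖ := h3.symm
      _ ≤ ‖c k‖ * (C * ∫ t, ‖u k t‖ * Real.exp (1 / 2 * |t|)) :=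
          mul_le_mul_of_nonneg_left h1 (norm_nonneg _)
      _ = C * ∫ t, ‖c k * u k t‖ * Real.exp (1 / 2 * |t|) := h2
      _ ≤ C * M := mul_le_mul_of_nonneg_left (hM k) hC0
  have hεk : -(C * M / η) ≤ weilGroundEnergy (a k) := by
    have : |weilGroundEnergy (a k)| ≤ C * M / η := by
      rw [le_div_iff₀ hη]
      exact key
    linarith [neg_abs_le (weilGroundEnergy (a k))]
  exact hεk.trans
    (Summit.RiemannHypothesis.Cruxes.GronwallLeakage.Negative.weilGroundEnergy_antitone_of_pos hA hAk)

/-- **NV at the polar exponent ⇒ RH.**  Ground states `u_k` along `a_k → ∞` and scalars `c_k`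
with `∫ |c_k u_k| e^{|t|/2} ≤ M`, whose test pairings converge to a functional `Λ` not vanishing
on one test function, imply RH (the tail of the sequence pairs non-degenerately with
`h₀ = conj ∘ g₀`). -/
theorem riemannHypothesis_of_halfTight_weakLimit_ne_zero
    (h : ∃ a : ℕ → ℝ, ∃ u : ℕ → ℝ → ℂ, ∃ c : ℕ → ℂ, Tendsto a atTop atTop ∧
      (∀ k, IsWeilGroundState (a k) (u k)) ∧
      (∃ M : ℝ, ∀ k, ∫ t, ‖c k * u k t‖ * Real.exp (1 / 2 * |t|) ≤ M) ∧
      ∃ Λ : (ℝ → ℂ) → ℂ, (∀ g : ℝ → ℂ, IsWeilTest g →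
        Tendsto (fun k => ∫ t, c k * u k t * g t) atTop (𝓝 (Λ g))) ∧
        ∃ g₀ : ℝ → ℂ, IsWeilTest g₀ ∧ Λ g₀ ≠ 0) :
    RiemannHypothesis := by
  obtain ⟨a, u, c, ha, hu, ⟨M, hM⟩, Λ, hweak, g₀, hg₀, hΛ⟩ := h
  set h₀ : ℝ → ℂ := fun t => conj (g₀ t) with hh₀def
  have hh₀ : IsWeilTest h₀ := isWeilTest_conj hg₀
  have hPpos : 0 < ‖Λ g₀‖ / 2 := by positivity
  have hev : ∀ᶠ k in atTop, ‖Λ g₀‖ / 2 ≤ ‖∫ t, c k * u k t * conj (h₀ t)‖ := by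
    have h1 := hweak g₀ hg₀
    rw [Metric.tendsto_nhds] at h1
    filter_upwards [h1 (‖Λ g₀‖ / 2) hPpos] with k hk
    rw [dist_eq_norm] at hk
    have hconj : (fun t => c k * u k t * conj (h₀ t)) = fun t => c k * u k t * g₀ t := by
      funext t
      simp [hh₀def]
    rw [hconj]
    have := norm_sub_norm_le (Λ g₀) (∫ t, c k * u k t * g₀ t)
    rw [← norm_neg, neg_sub] at hk
    linarith
  obtain ⟨K, hK⟩ := eventually_atTop.1 hev
  exact riemannHypothesis_of_nondegenerate_halfTight_groundStates
    ⟨fun k => a (k + K), fun k => u (k + K), fun k => c (k + K),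
      ha.comp (tendsto_add_atTop_nat K), fun k => hu (k + K), ⟨M, fun k => hM (k + K)⟩,
      ⟨h₀, hh₀, ‖Λ g₀‖ / 2, hPpos, fun k => hK (k + K) (Nat.le_add_left K k)⟩⟩

/-- **C⁺ with tightness at the polar exponent ⇒ RH.**  Ground states `u_k` along `a_k → ∞` and
scalars `c_k` with `∫ |c_k u_k| e^{|t|/2} ≤ M`, converging weakly against test functions to
Riemann's kernel `Φ = 2Ψ(2·)`, imply RH (a bump `h₀` at `0` has `∫ Φ h₀ ≠ 0`).  The line's stub
`stub_tightWeakLimit` asks the same bound for every exponent `b < 1/2` instead of `b = 1/2`. -/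
theorem riemannHypothesis_of_halfTightWeakLimit
    (h : ∃ a : ℕ → ℝ, ∃ u : ℕ → ℝ → ℂ, ∃ c : ℕ → ℂ, Tendsto a atTop atTop ∧
      (∀ k, IsWeilGroundState (a k) (u k)) ∧
      (∃ M : ℝ, ∀ k, ∫ t, ‖c k * u k t‖ * Real.exp (1 / 2 * |t|) ≤ M) ∧
      (∀ g : ℝ → ℂ, IsWeilTest g →
        Tendsto (fun k => ∫ t, c k * u k t * g t) atTop
          (𝓝 (∫ t, 2 * LagariasMontague.Psic (2 * t) * g t)))) :
    RiemannHypothesis := by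
  obtain ⟨a, u, c, ha, hu, htight, hweak⟩ := h
  obtain ⟨h₀, hh₀, -, hP⟩ := exists_isWeilTest_integral_phi_mul_ne_zero
  exact riemannHypothesis_of_halfTight_weakLimit_ne_zero ⟨a, u, c, ha, hu, htight,
    fun g => ∫ t, 2 * LagariasMontague.Psic (2 * t) * g t, hweak, h₀, hh₀, hP⟩

/-- Tightness at the polar exponent gives `L¹`-boundedness (`e^{|t|/2} ≥ 1`). [folklore] -/
theorem integral_norm_le_of_halfTight {a : ℕ → ℝ} {u : ℕ → ℝ → ℂ} {c : ℕ → ℂ}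
    (hu : ∀ k, IsWeilGroundState (a k) (u k)) {M : ℝ}
    (hM : ∀ k, ∫ t, ‖c k * u k t‖ * Real.exp (1 / 2 * |t|) ≤ M) (k : ℕ) :
    ∫ t, ‖c k * u k t‖ ≤ M := by
  refine le_trans (integral_mono_of_nonneg (ae_of_all _ fun t => norm_nonneg _)
    (stub_pointwise_of_weak_integrable_weight (hu k) (c k) (1 / 2)) (ae_of_all _ fun t => ?_)) (hM k)
  have h1 : 1 ≤ Real.exp (1 / 2 * |t|) := Real.one_le_exp (by positivity)
  simpa using mul_le_mul_of_nonneg_left h1 (norm_nonneg (c k * u k t))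

/-- **RH from a witness of the crux tight at the polar exponent** (critical-line form): ground
states `u_k` along `a_k → ∞`, scalars `c_k` with `∫ |c_k u_k| e^{|t|/2} ≤ M`, and
`c_k û_k → ξ` pointwise on the critical line imply RH (`tendsto_integral_mul_of_tendsto_criticalLine`
supplies the weak limit `Φ`). -/
theorem riemannHypothesis_of_halfTight_of_tendsto_criticalLine
    (h : ∃ a : ℕ → ℝ, ∃ u : ℕ → ℝ → ℂ, ∃ c : ℕ → ℂ, Tendsto a atTop atTop ∧
      (∀ k, IsWeilGroundState (a k) (u k)) ∧
      (∃ M : ℝ, ∀ k, ∫ t, ‖c k * u k t‖ * Real.exp (1 / 2 * |t|) ≤ M) ∧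
      (∀ τ : ℝ, Tendsto (fun k => c k * weilMellin (u k) (1 / 2 + τ * I)) atTop
        (𝓝 (riemannXi (1 / 2 + τ * I))))) :
    RiemannHypothesis := by
  obtain ⟨a, u, c, ha, hu, ⟨M, hM⟩, hline⟩ := h
  exact riemannHypothesis_of_halfTightWeakLimit ⟨a, u, c, ha, hu, ⟨M, hM⟩,
    fun g hg => tendsto_integral_mul_of_tendsto_criticalLine (fun k => (hu k).integrable)
      ⟨M, integral_norm_le_of_halfTight hu hM⟩ hline hg⟩

/-- **RH from a witness of the crux with bounded polar integrals.**  Ground states `u_k` along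
`a_k → ∞`, scalars `c_k`, `c_k · weilMellin u_k → ξ` locally uniformly on the open strip, and
`∫ |c_k u_k| e^{|t|/2} ≤ M` imply RH. -/
theorem riemannHypothesis_of_halfTight_cruxWitness
    (h : ∃ a : ℕ → ℝ, ∃ u : ℕ → ℝ → ℂ, ∃ c : ℕ → ℂ, Tendsto a atTop atTop ∧
      (∀ k, IsWeilGroundState (a k) (u k)) ∧
      (∃ M : ℝ, ∀ k, ∫ t, ‖c k * u k t‖ * Real.exp (1 / 2 * |t|) ≤ M) ∧
      TendstoLocallyUniformlyOn (fun k s => c k * weilMellin (u k) s) riemannXi atTop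
        {s : ℂ | 0 < s.re ∧ s.re < 1}) :
    RiemannHypothesis := by
  obtain ⟨a, u, c, ha, hu, htight, hlim⟩ := h
  refine riemannHypothesis_of_halfTight_of_tendsto_criticalLine ⟨a, u, c, ha, hu, htight,
    fun τ => hlim.tendsto_at ?_⟩
  constructor <;> norm_num

/-- **RH from `GroundStatesConvergeToXi` with bounded polar integrals** — the crux's clauses
verbatim plus `∫ |c_k u_k| e^{|t|/2} ≤ M` imply RH (no `GroundStateSimpleEven`, no
Connes–van Suijlekom, no Hurwitz). -/
theorem riemannHypothesis_of_groundStatesConvergeToXi_halfTight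
    (h : ∃ a : ℕ → ℝ, ∃ u : ℕ → ℝ → ℂ, ∃ c : ℕ → ℂ, Tendsto a atTop atTop ∧
      (∀ k, 0 < a k ∧ c k ≠ 0 ∧ MemLp (u k) 2 ∧ ∃ g : ℕ → ℝ → ℂ,
        (∀ n, IsWeilTest (g n) ∧ tsupport (g n) ⊆ Icc (-(a k)) (a k) ∧
          ∫ t, ‖g n t‖ ^ 2 = (1 : ℝ)) ∧
        Tendsto (fun n => (weilQuadratic (g n)).re) atTop (𝓝 (weilGroundEnergy (a k))) ∧
        Tendsto (fun n => ∫ t, ‖g n t - u k t‖ ^ 2) atTop (𝓝 0)) ∧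
      (∃ M : ℝ, ∀ k, ∫ t, ‖c k * u k t‖ * Real.exp (1 / 2 * |t|) ≤ M) ∧
      TendstoLocallyUniformlyOn (fun k s => c k * weilMellin (u k) s) riemannXi atTop
        {s : ℂ | 0 < s.re ∧ s.re < 1}) :
    RiemannHypothesis := by
  obtain ⟨a, u, c, ha, hk, htight, hlim⟩ := h
  exact riemannHypothesis_of_halfTight_cruxWitness
    ⟨a, u, c, ha, fun k => ⟨(hk k).2.2.1, (hk k).2.2.2⟩, htight, hlim⟩

/-- **Polar escape under ¬RH.**  If RH fails, then for EVERY witness `(a_k, u_k, c_k)` of the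
crux's shape the polar integrals `∫ |c_k u_k| e^{|t|/2}` are unbounded in `k`. -/
theorem not_halfTight_cruxWitness_of_not_riemannHypothesis (hRH : ¬ RiemannHypothesis)
    {a : ℕ → ℝ} {u : ℕ → ℝ → ℂ} {c : ℕ → ℂ} (ha : Tendsto a atTop atTop)
    (hu : ∀ k, IsWeilGroundState (a k) (u k))
    (hlim : TendstoLocallyUniformlyOn (fun k s => c k * weilMellin (u k) s) riemannXi atTop
      {s : ℂ | 0 < s.re ∧ s.re < 1}) (M : ℝ) :
    ∃ k, M < ∫ t, ‖c k * u k t‖ * Real.exp (1 / 2 * |t|) := by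
  by_contra hcon
  push Not at hcon
  exact hRH (riemannHypothesis_of_halfTight_cruxWitness ⟨a, u, c, ha, hu, ⟨M, hcon⟩, hlim⟩)

end Summit.RiemannHypothesis.RiemannHypothesis.Theorems.GroundStatesConvergeToXi

end
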